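import Summits.QuantumFields.YangMills.Theorems.FluctuationComparisonRegPrIntLOrganTangentILawKerXOfScoreProfile
import HarnessLib

/-!
# Crux `FluctuationComparisonRegPrIntL` (stmt-QuantumFields-20520, rung R3), PATH-B organ, H-currency cone — (L47) «KER′ OF THE (I-law-V3)sq BLOCK BY THE REAL ROAD»: the
# kernel `kV₃` FROM a profiled THIRD CENTRAL MOMENT of the fibre law at the PATH law points × the transported-difference profile × the symmetric-sum profile × the
# SCORE PROFILE (the cubic twin of ✓`…OrganTangentILawKerXOfScoreProfile` (L46′); px5 g22 §81 (R-real))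

Cell `ym3-torus` (YM ladder rung R3 = continuum `SU(2)` Yang–Mills on the three-torus — a RUNG: NOT d = 4, NOT infinite volume, NOT a mass gap, NOT Clay).
Width seat `ym-ust-20520-w5` (gen 25), `--kind proof --supports stmt-QuantumFields-20520 --as helper`, count-neutral, DEFINITION-FREE, default heartbeats,
no registry ∕ binder ∕ `Lines/` edit.  Over ✓`…OrganTangentILawKerXOfScoreProfile` (`rowMass_sandwich_le₂`), ✓`…RunpairOrganFibreLawDefs` (`wNum`).

WHY.  The KER′ half of the (I-law-V3)sq block of row-sq v0.3 ∕ v0.4 (✓`…OrganTangentLawClausesOfILawAE` `hIlawV3`) reads, at a.e. `s ∈ [0,1]` along a near relational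
path `X` (one coarse move `m′` at `B′`), with `D := h(V₁) − h(U₁)` (the transported difference, first order in `m` at `B`), `S := h(V₁) + h(U₁)`, `h := log ρ_Ts∘Φ − log ρ′_Ts∘Φ`,
`Sc_s := deriv_s wNum ∕ wNum` the score of the moving weight and `E := ∫ · Law_t(X s)`:
`|Cov(D·S, Sc_s) − Cov(D, Sc_s)·E S − E D·Cov(S, Sc_s)| ≤ kV₃ B B′·(‖m‖∕θc)·(‖m′‖∕θc)`.  The integrand IS the joint third cumulant `κ₃(D, S, Sc_s)`, and a third cumulant
is a third CENTRAL moment: `κ₃(D, S, Sc_s) = ∫ (D − E D)(S − E S)(Sc_s − E Sc_s)·Law` — pure algebra under `∫ Law = 1` (§0).  So the honest real road (px5 g22 §81 ∕ 13:32Z (3):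
«blocks L∕V3∕V4 need real third-cumulant control for the cut-score insertions anyway») is ONE letter (G₃^{prof}) — a profiled third-central-moment TREE KERNEL of the tilted fibre
law at the path law point, covering smooth AND cut score at once — times the three profiles: `D` by `(‖m‖∕θc)·K(·,B)` ([Balaban1985Variational] Thm 1 (9)–(10): first-order
transport), `S` by an `O(1)` family `KS` (two copies of `h`), `Sc_s` by `(‖m′‖∕θc)·Q₁(·;B′)` (the (SC-PROF-X) letter of (L46′): background derivatives of `Δ_k`, `V_n`, the
Jacobian — [5] (3.155)–(3.156), [7] (174)–(181), [B12] p.267 — and ramp slopes × per-level displacement) — SOURCES of the shapes only.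

WHAT.  §0 [folklore] `kappa3_eq_integral_centred` (the displayed combination of un-centred moments `=` the centred triple moment under `∫L = 1`), `sandwich3_abs_sizes_eq`
(pull the two sizes out and contract the middle index: `Σ_{a,b,c} |s·K a B|·|KS b|·|s′·Q c B′|·𝒢₃ a b c = (Σ_{a,c} K a B·(Σ_b KS b·𝒢₃ a b c)·Q c B′)·s·s′`).
§1 ★★`kerV3Clause_of_cum3Kernel_profiles` — ABSTRACT DOOR (`Fobs`, `Law`, `Sc : ℝ → (ℝ → G_j) → ℝ → Z → ℝ`, a profile predicate `Prof` INDEXED BY THE LAW POINT, as in (L46′)):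
from (G₃^{prof}) at the PATH LAW POINT, (K1-path), (S-PROF), (SC-PROF-X), the law facts at `X s` read `∀ᵐ s` (normalisation + eight integrabilities) and masses (`K` column∕row,
`Q₁` row∕column, the `KS`-CONTRACTED kernel `𝒢₃^S a c := Σ_b KS b·𝒢₃ a b c` row∕column w.r.t. `ωf`, multiplicative triangle `htri`) ⟹ `∃ kV₃ ≥ 0` with BOTH κ-masses
`≤ Ncol·NG·Nrow ≤ M` (✓`rowMass_sandwich_le₂` VERBATIM with `k := 𝒢₃^S`) and the KER′(V3) SHAPE, `kV₃ B B′ := Σ_{a,c} K a B·𝒢₃^S a c·Q₁ c B′`.  §2 ★★`kerV3_organ` — the ORGAN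
DOCK: `Fobs := h_Ts∘Φ`, `Law t Xw z := wNum_t Xw z ∕ ∫ wNum_t Xw`, `Sc t X s z := deriv (σ ↦ wNum_t (X σ) z) s ∕ wNum_t (X s) z`, `θc := θ_j∕4`: the KER′ conjunct text of
`hIlawV3` VERBATIM (to be paired with ✓p823910's REG′ `ilawRegV3_of_beta_of_incr`).

HONEST FRAMING: a door between HYPOTHESIS letters; (G₃^{prof}), (K1-path), (S-PROF), (SC-PROF-X) are exactly as OPEN as KER′(V3) (bottom: §76 G2-b — volume-free tree decay of
the tilted `m`-step fibre law's third cumulant); nothing of Bałaban's analysis is asserted or proved; REG′ is ✓p823910's business, not touched; (I-curv), (I-cov),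
`OrganDischargeInputsHJ(sq)` ∕ `SpreadFibreLawH(J)(sq)` UNDISCHARGED; the five registered stubs of `Lines/semiclassical_s2beta.lean`, crux 20520 and `YM3TorusSU2` are NOT
proved; registry untouched; rung R3 = SU(2) YM₃ on T³ — NOT d = 4, NOT infinite volume, NOT a mass gap, NOT Clay; the Yang–Mills mass gap is NOT proved.  [folklore]
-/

set_option autoImplicit false

noncomputable section

namespace Summit.QuantumFields.YangMills.Theorems.OrganTangentILawKerV3OfScoreProfile

open MeasureTheory
open scoped BigOperators
open Literature.MathematicalPhysics.QuantumFieldTheory.Balaban1983to89 T3ContinuumYM3Torus T3NestedUnitLaws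
  T3UnitLawDensityEML T4Continuum BalabanUVClass T3UnitScaleTilt T3LevelShift T3TiltDescent
open T4CubeChartExp (expPt)
open Summit.QuantumFields.YangMills.Theorems.OrganTangentILawKerXOfScoreProfile (rowMass_sandwich_le₂)
open Summit.QuantumFields.YangMills.Theorems.FluctuationComparisonRegPrIntLRunpairOrganFibreLaw (wNum)

/-! ## §0 Folklore: third cumulant = third central moment; three-profile sandwich with the middle index contracted -/

section Folklore

variable {Z : Type*} [MeasurableSpace Z]

/-- **THIRD CUMULANT = THIRD CENTRAL MOMENT** under a normalised weight: with `E f := ∫ f·L`, `∫ L = 1`,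
`(E(PQR) − E(PQ)·E R) − ((E(PR) − E P·E R)·E Q + E P·(E(QR) − E Q·E R)) = ∫ (P − E P)(Q − E Q)(R − E R)·L`. [folklore] -/
theorem kappa3_eq_integral_centred (τ : Measure Z) (P Q R L : Z → ℝ)
    (hL : Integrable L τ) (hn : ∫ z, L z ∂τ = 1) (hP : Integrable (fun z => P z * L z) τ) (hQ : Integrable (fun z => Q z * L z) τ)
    (hR : Integrable (fun z => R z * L z) τ) (hPQ : Integrable (fun z => P z * Q z * L z) τ) (hPR : Integrable (fun z => P z * R z * L z) τ)
    (hQR : Integrable (fun z => Q z * R z * L z) τ) (hPQR : Integrable (fun z => P z * Q z * R z * L z) τ) :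
    ((∫ z, P z * Q z * R z * L z ∂τ) - (∫ z, P z * Q z * L z ∂τ) * (∫ z, R z * L z ∂τ))
        - (((∫ z, P z * R z * L z ∂τ) - (∫ z, P z * L z ∂τ) * (∫ z, R z * L z ∂τ)) * (∫ z, Q z * L z ∂τ)
            + (∫ z, P z * L z ∂τ) * ((∫ z, Q z * R z * L z ∂τ) - (∫ z, Q z * L z ∂τ) * (∫ z, R z * L z ∂τ)))
      = ∫ z, (P z - ∫ z', P z' * L z' ∂τ) * (Q z - ∫ z', Q z' * L z' ∂τ) * (R z - ∫ z', R z' * L z' ∂τ) * L z ∂τ := by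
  set a : ℝ := ∫ z', P z' * L z' ∂τ with ha
  set b : ℝ := ∫ z', Q z' * L z' ∂τ with hb
  set c : ℝ := ∫ z', R z' * L z' ∂τ with hc
  have e : (∫ z, (P z - a) * (Q z - b) * (R z - c) * L z ∂τ)
      = ∫ z, (((((((P z * Q z * R z * L z - c * (P z * Q z * L z)) - b * (P z * R z * L z)) - a * (Q z * R z * L z))
          + (b * c) * (P z * L z)) + (a * c) * (Q z * L z)) + (a * b) * (R z * L z)) - (a * b * c) * L z) ∂τ := by
    congr 1; funext z; ring
  have i1 : Integrable (fun z => P z * Q z * R z * L z - c * (P z * Q z * L z)) τ := hPQR.sub (hPQ.const_mul c)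
  have i2 : Integrable (fun z => (P z * Q z * R z * L z - c * (P z * Q z * L z)) - b * (P z * R z * L z)) τ := i1.sub (hPR.const_mul b)
  have i3 : Integrable (fun z => ((P z * Q z * R z * L z - c * (P z * Q z * L z)) - b * (P z * R z * L z)) - a * (Q z * R z * L z)) τ :=
    i2.sub (hQR.const_mul a)
  have i4 : Integrable (fun z => (((P z * Q z * R z * L z - c * (P z * Q z * L z)) - b * (P z * R z * L z)) - a * (Q z * R z * L z))
      + (b * c) * (P z * L z)) τ := i3.add (hP.const_mul _)
  have i5 : Integrable (fun z => ((((P z * Q z * R z * L z - c * (P z * Q z * L z)) - b * (P z * R z * L z)) - a * (Q z * R z * L z))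
      + (b * c) * (P z * L z)) + (a * c) * (Q z * L z)) τ := i4.add (hQ.const_mul _)
  have i6 : Integrable (fun z => (((((P z * Q z * R z * L z - c * (P z * Q z * L z)) - b * (P z * R z * L z)) - a * (Q z * R z * L z))
      + (b * c) * (P z * L z)) + (a * c) * (Q z * L z)) + (a * b) * (R z * L z)) τ := i5.add (hR.const_mul _)
  rw [e, integral_sub i6 (hL.const_mul _), integral_add i5 (hR.const_mul _), integral_add i4 (hQ.const_mul _), integral_add i3 (hP.const_mul _),
    integral_sub i2 (hQR.const_mul a), integral_sub i1 (hPR.const_mul b), integral_sub hPQR (hPQ.const_mul c),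
    integral_const_mul, integral_const_mul, integral_const_mul, integral_const_mul, integral_const_mul, integral_const_mul, integral_const_mul, hn]
  ring

variable {ι ιc : Type*} [Fintype ι]

/-- Three-profile form of ✓`sandwich_abs_sizes_eq₂` with the MIDDLE index contracted against an `O(1)` family:
`Σ_{a,b,c} |s·K a B|·|KS b|·|s′·Q c B′|·𝒢₃ a b c = (Σ_{a,c} K a B·(Σ_b KS b·𝒢₃ a b c)·Q c B′)·s·s′`. [folklore] -/
theorem sandwich3_abs_sizes_eq (K Q : ι → ιc → ℝ) (KS : ι → ℝ) (𝒢₃ : ι → ι → ι → ℝ) (hK : ∀ a B, 0 ≤ K a B) (hQ : ∀ a B, 0 ≤ Q a B)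
    (hKS : ∀ b, 0 ≤ KS b) (B B' : ιc) {s s' : ℝ} (hs : 0 ≤ s) (hs' : 0 ≤ s') :
    ∑ a, ∑ b, ∑ c, |s * K a B| * |KS b| * |s' * Q c B'| * 𝒢₃ a b c = (∑ a, ∑ c, K a B * (∑ b, KS b * 𝒢₃ a b c) * Q c B') * s * s' := by
  rw [Finset.sum_mul, Finset.sum_mul]
  refine Finset.sum_congr rfl fun a _ => ?_
  rw [Finset.sum_comm, Finset.sum_mul, Finset.sum_mul]
  refine Finset.sum_congr rfl fun c _ => ?_
  rw [Finset.mul_sum, Finset.sum_mul, Finset.sum_mul, Finset.sum_mul]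
  refine Finset.sum_congr rfl fun b _ => ?_
  rw [abs_of_nonneg (mul_nonneg hs (hK a B)), abs_of_nonneg (hKS b), abs_of_nonneg (mul_nonneg hs' (hQ c B'))]
  ring

end Folklore

/-! ## §1 The abstract door: KER′(V3) shape from the third central moment kernel at path law points × difference ∕ sum ∕ score profiles -/

section Abstract

variable {P : Params} {j : ℕ} {ι : Type*} [Fintype ι] {Z : Type*} [MeasurableSpace Z]

/-- ★★ **KER′ OF THE (I-law-V3)sq BLOCK ⟸ (G₃^{prof}) × (K1-path) × (S-PROF) × (SC-PROF-X)** — abstract currency; see the module docstring. [folklore] -/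
theorem kerV3Clause_of_cum3Kernel_profiles (τ : Measure Z) (Fobs : GaugeField P j ↥(Matrix.specialUnitaryGroup (Fin 2) ℂ) → Z → ℝ)
    (Law : ℝ → GaugeField P j ↥(Matrix.specialUnitaryGroup (Fin 2) ℂ) → Z → ℝ)
    (Sc : ℝ → (ℝ → GaugeField P j ↥(Matrix.specialUnitaryGroup (Fin 2) ℂ)) → ℝ → Z → ℝ)
    (θc rc κ M : ℝ) (hθc : 0 < θc)
    (Prof : GaugeField P j ↥(Matrix.specialUnitaryGroup (Fin 2) ℂ) → (Z → ℝ) → (ι → ℝ) → Prop)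
    -- (G₃^{prof}) the third central moment kernel at the PATH law points, observables profiled there, t-uniform; masses of its `KS`-contraction
    (𝒢₃ : ι → ι → ι → ℝ) (KS : ι → ℝ) (ωf : ι → ι → ℝ) (NG : ℝ) (hG0 : ∀ a b c, 0 ≤ 𝒢₃ a b c) (hKS0 : ∀ b, 0 ≤ KS b) (hωf : ∀ a c, 0 ≤ ωf a c) (hNG : 0 ≤ NG)
    (hGrow : ∀ a, ∑ c, (∑ b, KS b * 𝒢₃ a b c) * ωf a c ≤ NG) (hGcol : ∀ c, ∑ a, (∑ b, KS b * 𝒢₃ a b c) * ωf a c ≤ NG) (hωfsymm : ∀ a c, ωf a c = ωf c a)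
    (hCum : ∀ t : ℝ, 0 ≤ t → t ≤ 1 → ∀ (B B' : PBond P j) (m m' : Fin 3 → ℝ) (U₁ V₁ W₂ : GaugeField P j ↥(Matrix.specialUnitaryGroup (Fin 2) ℂ)),
      ‖m‖ ≤ rc * θc → ‖m'‖ ≤ rc * θc → PlaqSmall θc U₁ → PlaqSmall θc V₁ → PlaqSmall θc W₂ →
      (∀ e, e ≠ B → V₁ e = U₁ e) → V₁ B = U₁ B * expPt m → (∀ e, e ≠ B' → W₂ e = V₁ e) → W₂ B' = V₁ B' * expPt m' →
      ∀ (X : ℝ → GaugeField P j ↥(Matrix.specialUnitaryGroup (Fin 2) ℂ)), (∀ s e, e ≠ B' → X s e = V₁ e) → (∀ s, X s B' = V₁ B' * expPt (s • m')) →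
      ∀ s ∈ Set.Icc (0:ℝ) 1, ∀ (Pf Qf Rf : Z → ℝ) (p q r : ι → ℝ), Prof (X s) Pf p → Prof (X s) Qf q → Prof (X s) Rf r → ∀ (cP cQ cR : ℝ),
        cP = ∫ z, Pf z * Law t (X s) z ∂τ → cQ = ∫ z, Qf z * Law t (X s) z ∂τ → cR = ∫ z, Rf z * Law t (X s) z ∂τ →
          Integrable (fun z => (Pf z - cP) * (Qf z - cQ) * (Rf z - cR) * Law t (X s) z) τ ∧
            |∫ z, (Pf z - cP) * (Qf z - cQ) * (Rf z - cR) * Law t (X s) z ∂τ| ≤ ∑ a, ∑ b, ∑ c, |p a| * |q b| * |r c| * 𝒢₃ a b c)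
    -- (K1-path) ∕ (SC-PROF-X): profiles of the transported difference and of the score at the path law points; their masses
    (K Q₁ : ι → PBond P j → ℝ) (ωX : ι → PBond P j → ℝ) (Ncol Nrow : ℝ) (hK0 : ∀ a B, 0 ≤ K a B) (hQ0 : ∀ a B, 0 ≤ Q₁ a B) (hωX : ∀ a B, 0 ≤ ωX a B)
    (hNcol : 0 ≤ Ncol) (hNrow : 0 ≤ Nrow)
    (hKcol : ∀ B, ∑ a, K a B * ωX a B ≤ Ncol) (hKrow : ∀ c, ∑ B', K c B' * ωX c B' ≤ Ncol)
    (hQrow : ∀ c, ∑ B', Q₁ c B' * ωX c B' ≤ Nrow) (hQcol : ∀ B, ∑ a, Q₁ a B * ωX a B ≤ Nrow)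
    (htri : ∀ (B B' : PBond P j) (a c : ι), Real.exp (κ * (B.src.tdist B'.src : ℝ)) ≤ ωX a B * ωf a c * ωX c B')
    (htdsymm : ∀ B B' : PBond P j, (B.src.tdist B'.src : ℝ) = (B'.src.tdist B.src : ℝ))
    -- (K1-path) ∧ (S-PROF) ∧ (SC-PROF-X) at the path law points
    (hProfF : ∀ t : ℝ, 0 ≤ t → t ≤ 1 → ∀ (B B' : PBond P j) (m m' : Fin 3 → ℝ) (U₁ V₁ W₂ : GaugeField P j ↥(Matrix.specialUnitaryGroup (Fin 2) ℂ)),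
      ‖m‖ ≤ rc * θc → ‖m'‖ ≤ rc * θc → PlaqSmall θc U₁ → PlaqSmall θc V₁ → PlaqSmall θc W₂ →
      (∀ e, e ≠ B → V₁ e = U₁ e) → V₁ B = U₁ B * expPt m → (∀ e, e ≠ B' → W₂ e = V₁ e) → W₂ B' = V₁ B' * expPt m' →
      ∀ (X : ℝ → GaugeField P j ↥(Matrix.specialUnitaryGroup (Fin 2) ℂ)), (∀ s e, e ≠ B' → X s e = V₁ e) → (∀ s, X s B' = V₁ B' * expPt (s • m')) →
      ∀ s ∈ Set.Icc (0:ℝ) 1,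
        Prof (X s) (fun z => Fobs V₁ z - Fobs U₁ z) (fun a => ‖m‖ / θc * K a B) ∧ Prof (X s) (fun z => Fobs V₁ z + Fobs U₁ z) KS ∧
          Prof (X s) (Sc t X s) (fun a => ‖m'‖ / θc * Q₁ a B'))
    -- the law facts at the path law points, a.e. in the path parameter
    (hlaw : ∀ t : ℝ, 0 ≤ t → t ≤ 1 → ∀ (B B' : PBond P j) (m m' : Fin 3 → ℝ) (U₁ V₁ W₂ : GaugeField P j ↥(Matrix.specialUnitaryGroup (Fin 2) ℂ)),
      ‖m‖ ≤ rc * θc → ‖m'‖ ≤ rc * θc → PlaqSmall θc U₁ → PlaqSmall θc V₁ → PlaqSmall θc W₂ →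
      (∀ e, e ≠ B → V₁ e = U₁ e) → V₁ B = U₁ B * expPt m → (∀ e, e ≠ B' → W₂ e = V₁ e) → W₂ B' = V₁ B' * expPt m' →
      ∀ (X : ℝ → GaugeField P j ↥(Matrix.specialUnitaryGroup (Fin 2) ℂ)), (∀ s e, e ≠ B' → X s e = V₁ e) → (∀ s, X s B' = V₁ B' * expPt (s • m')) →
      ∀ᵐ s ∂(volume : Measure ℝ), s ∈ Set.Icc (0:ℝ) 1 →
        Integrable (fun z => Law t (X s) z) τ ∧ ∫ z, Law t (X s) z ∂τ = 1 ∧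
        Integrable (fun z => (Fobs V₁ z - Fobs U₁ z) * Law t (X s) z) τ ∧ Integrable (fun z => (Fobs V₁ z + Fobs U₁ z) * Law t (X s) z) τ ∧
        Integrable (fun z => Sc t X s z * Law t (X s) z) τ ∧
        Integrable (fun z => (Fobs V₁ z - Fobs U₁ z) * (Fobs V₁ z + Fobs U₁ z) * Law t (X s) z) τ ∧
        Integrable (fun z => (Fobs V₁ z - Fobs U₁ z) * Sc t X s z * Law t (X s) z) τ ∧
        Integrable (fun z => (Fobs V₁ z + Fobs U₁ z) * Sc t X s z * Law t (X s) z) τ ∧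
        Integrable (fun z => (Fobs V₁ z - Fobs U₁ z) * (Fobs V₁ z + Fobs U₁ z) * Sc t X s z * Law t (X s) z) τ)
    (hM : Ncol * NG * Nrow ≤ M) :
    ∃ kV₃ : PBond P j → PBond P j → ℝ, (∀ B B', 0 ≤ kV₃ B B') ∧
      (∀ B, ∑ B', kV₃ B B' * Real.exp (κ * (B.src.tdist B'.src : ℝ)) ≤ M) ∧
      (∀ B', ∑ B, kV₃ B B' * Real.exp (κ * (B.src.tdist B'.src : ℝ)) ≤ M) ∧
      ∀ t : ℝ, 0 ≤ t → t ≤ 1 → ∀ (B B' : PBond P j) (m m' : Fin 3 → ℝ) (U₁ V₁ W₂ : GaugeField P j ↥(Matrix.specialUnitaryGroup (Fin 2) ℂ)),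
        ‖m‖ ≤ rc * θc → ‖m'‖ ≤ rc * θc → PlaqSmall θc U₁ → PlaqSmall θc V₁ → PlaqSmall θc W₂ →
        (∀ e, e ≠ B → V₁ e = U₁ e) → V₁ B = U₁ B * expPt m → (∀ e, e ≠ B' → W₂ e = V₁ e) → W₂ B' = V₁ B' * expPt m' →
        ∀ (X : ℝ → GaugeField P j ↥(Matrix.specialUnitaryGroup (Fin 2) ℂ)), (∀ s e, e ≠ B' → X s e = V₁ e) → (∀ s, X s B' = V₁ B' * expPt (s • m')) →
        ∀ᵐ s ∂(volume : Measure ℝ), s ∈ Set.Icc (0:ℝ) 1 →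
          |(((∫ z, (Fobs V₁ z - Fobs U₁ z) * (Fobs V₁ z + Fobs U₁ z) * Sc t X s z * Law t (X s) z ∂τ)
                - (∫ z, (Fobs V₁ z - Fobs U₁ z) * (Fobs V₁ z + Fobs U₁ z) * Law t (X s) z ∂τ) * (∫ z, Sc t X s z * Law t (X s) z ∂τ))
              - (((∫ z, (Fobs V₁ z - Fobs U₁ z) * Sc t X s z * Law t (X s) z ∂τ)
                    - (∫ z, (Fobs V₁ z - Fobs U₁ z) * Law t (X s) z ∂τ) * (∫ z, Sc t X s z * Law t (X s) z ∂τ)) * (∫ z, (Fobs V₁ z + Fobs U₁ z) * Law t (X s) z ∂τ)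
                  + (∫ z, (Fobs V₁ z - Fobs U₁ z) * Law t (X s) z ∂τ)
                      * ((∫ z, (Fobs V₁ z + Fobs U₁ z) * Sc t X s z * Law t (X s) z ∂τ)
                          - (∫ z, (Fobs V₁ z + Fobs U₁ z) * Law t (X s) z ∂τ) * (∫ z, Sc t X s z * Law t (X s) z ∂τ))))|
            ≤ kV₃ B B' * (‖m‖ / θc) * (‖m'‖ / θc) := by
  have hGS0 : ∀ a c, 0 ≤ ∑ b, KS b * 𝒢₃ a b c := fun a c => Finset.sum_nonneg fun b _ => mul_nonneg (hKS0 b) (hG0 a b c)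
  refine ⟨fun B B' => ∑ a, ∑ c, K a B * (∑ b, KS b * 𝒢₃ a b c) * Q₁ c B', fun B B' => ?_, fun B => ?_, fun B' => ?_, ?_⟩
  · exact Finset.sum_nonneg fun a _ => Finset.sum_nonneg fun c _ => mul_nonneg (mul_nonneg (hK0 a B) (hGS0 a c)) (hQ0 c B')
  · exact (rowMass_sandwich_le₂ (fun a c => ∑ b, KS b * 𝒢₃ a b c) K Q₁ ωf (fun B B' => Real.exp (κ * (B.src.tdist B'.src : ℝ))) ωX hGS0 hK0 hQ0 hωf hωX
      htri hNG hNrow hKcol hQrow hGrow B).trans hM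
  · -- column mass: transpose the sandwich
    have e : ∀ B, (∑ a, ∑ c, K a B * (∑ b, KS b * 𝒢₃ a b c) * Q₁ c B') = ∑ c, ∑ a, Q₁ c B' * (∑ b, KS b * 𝒢₃ a b c) * K a B := by
      intro B; rw [Finset.sum_comm]; exact Finset.sum_congr rfl fun c _ => Finset.sum_congr rfl fun a _ => by ring
    have h := rowMass_sandwich_le₂ (fun c a => ∑ b, KS b * 𝒢₃ a b c) Q₁ K (fun c a => ωf a c) (fun B'' B => Real.exp (κ * (B.src.tdist B''.src : ℝ))) ωX
      (fun c a => hGS0 a c) hQ0 hK0 (fun c a => hωf a c) hωX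
      (fun B'' B c a => by rw [htdsymm]; calc Real.exp (κ * (B''.src.tdist B.src : ℝ)) ≤ ωX c B'' * ωf c a * ωX a B := htri B'' B c a
        _ = ωX c B'' * ωf a c * ωX a B := by rw [hωfsymm])
      hNG hNcol hQcol hKrow (fun c => by simpa using hGcol c) B'
    calc ∑ B, (∑ a, ∑ c, K a B * (∑ b, KS b * 𝒢₃ a b c) * Q₁ c B') * Real.exp (κ * (B.src.tdist B'.src : ℝ))
        = ∑ B, (∑ c, ∑ a, Q₁ c B' * (∑ b, KS b * 𝒢₃ a b c) * K a B) * Real.exp (κ * (B.src.tdist B'.src : ℝ)) :=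
          Finset.sum_congr rfl fun B _ => by rw [e]
      _ ≤ Nrow * NG * Ncol := h
      _ = Ncol * NG * Nrow := by ring
      _ ≤ M := hM
  · intro t ht0 ht1 B B' m m' U₁ V₁ W₂ hm hm' hU hV hW hVU hVB hWU hWB X hoff hon
    filter_upwards [hlaw t ht0 ht1 B B' m m' U₁ V₁ W₂ hm hm' hU hV hW hVU hVB hWU hWB X hoff hon] with s hs hsI
    obtain ⟨hLi, hLn, hDi, hSi, hSci, hDSi, hDSci, hSSci, hDSSci⟩ := hs hsI
    obtain ⟨hp, hq, hr⟩ := hProfF t ht0 ht1 B B' m m' U₁ V₁ W₂ hm hm' hU hV hW hVU hVB hWU hWB X hoff hon s hsI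
    obtain ⟨-, hbd⟩ := hCum t ht0 ht1 B B' m m' U₁ V₁ W₂ hm hm' hU hV hW hVU hVB hWU hWB X hoff hon s hsI _ _ _ _ _ _ hp hq hr _ _ _ rfl rfl rfl
    rw [kappa3_eq_integral_centred τ _ _ _ _ hLi hLn hDi hSi hSci hDSi hDSci hSSci hDSSci]
    refine hbd.trans (le_of_eq ?_)
    exact sandwich3_abs_sizes_eq K Q₁ KS 𝒢₃ hK0 hQ0 hKS0 B B' (div_nonneg (norm_nonneg _) hθc.le) (div_nonneg (norm_nonneg _) hθc.le)

end Abstract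

/-! ## §2 The organ dock: ✓p821651's `hIlawV3` KER′ conjunct text -/

section Organ

variable {ι : Type*} [Fintype ι]

/-- ★★ **THE ORGAN READING OF §1** — `Fobs := h_Ts∘Φ`, `Law t Xw z := wNum_t Xw z ∕ ∫ wNum_t Xw`, `Sc t X s z := deriv (σ ↦ wNum_t (X σ) z) s ∕ wNum_t (X s) z`,
`θc := θ_j∕4`: the KER′ conjunct of the (I-law-V3)sq block VERBATIM (to be paired with ✓p823910's REG′ `ilawRegV3_of_beta_of_incr`). [folklore] -/
theorem kerV3_organ (F : T3Family) (γ b₀ p₀ : ℝ) (j Ts : ℕ)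
    (ρ ρ' : (i : ℕ) → GaugeField (F.P i) 0 ↥(Matrix.specialUnitaryGroup (Fin 2) ℂ) → ℝ) {Z : Type} [MeasurableSpace Z] (τ : Measure Z)
    (Φ : GaugeField (F.P j) 0 ↥(Matrix.specialUnitaryGroup (Fin 2) ℂ) × Z → GaugeField (F.P Ts) 0 ↥(Matrix.specialUnitaryGroup (Fin 2) ℂ))
    (J : GaugeField (F.P j) 0 ↥(Matrix.specialUnitaryGroup (Fin 2) ℂ) × Z → NNReal)
    (rc κ M : ℝ) (hθ : 0 < θBal F.L γ b₀ p₀ j)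
    (Prof : GaugeField (F.P j) 0 ↥(Matrix.specialUnitaryGroup (Fin 2) ℂ) → (Z → ℝ) → (ι → ℝ) → Prop)
    -- (G₃^{prof}) the third central moment kernel at the PATH law points, observables profiled there, t-uniform; masses of its `KS`-contraction
    (𝒢₃ : ι → ι → ι → ℝ) (KS : ι → ℝ) (ωf : ι → ι → ℝ) (NG : ℝ) (hG0 : ∀ a b c, 0 ≤ 𝒢₃ a b c) (hKS0 : ∀ b, 0 ≤ KS b) (hωf : ∀ a c, 0 ≤ ωf a c) (hNG : 0 ≤ NG)
    (hGrow : ∀ a, ∑ c, (∑ b, KS b * 𝒢₃ a b c) * ωf a c ≤ NG) (hGcol : ∀ c, ∑ a, (∑ b, KS b * 𝒢₃ a b c) * ωf a c ≤ NG) (hωfsymm : ∀ a c, ωf a c = ωf c a)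
    (hCum : ∀ t : ℝ, 0 ≤ t → t ≤ 1 → ∀ (B B' : PBond (F.P j) 0) (m m' : Fin 3 → ℝ) (U₁ V₁ W₂ : GaugeField (F.P j) 0 ↥(Matrix.specialUnitaryGroup (Fin 2) ℂ)),
      ‖m‖ ≤ rc * (θBal F.L γ b₀ p₀ j / 4) → ‖m'‖ ≤ rc * (θBal F.L γ b₀ p₀ j / 4) → PlaqSmall (θBal F.L γ b₀ p₀ j / 4) U₁ → PlaqSmall (θBal F.L γ b₀ p₀ j / 4) V₁ → PlaqSmall (θBal F.L γ b₀ p₀ j / 4) W₂ →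
      (∀ e, e ≠ B → V₁ e = U₁ e) → V₁ B = U₁ B * expPt m → (∀ e, e ≠ B' → W₂ e = V₁ e) → W₂ B' = V₁ B' * expPt m' →
      ∀ (X : ℝ → GaugeField (F.P j) 0 ↥(Matrix.specialUnitaryGroup (Fin 2) ℂ)), (∀ s e, e ≠ B' → X s e = V₁ e) → (∀ s, X s B' = V₁ B' * expPt (s • m')) →
      ∀ s ∈ Set.Icc (0:ℝ) 1, ∀ (Pf Qf Rf : Z → ℝ) (p q r : ι → ℝ), Prof (X s) Pf p → Prof (X s) Qf q → Prof (X s) Rf r → ∀ (cP cQ cR : ℝ),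
        cP = ∫ z, Pf z * (wNum F γ b₀ p₀ j Ts ρ ρ' Φ J t (X s) z / ∫ z', wNum F γ b₀ p₀ j Ts ρ ρ' Φ J t (X s) z' ∂τ) ∂τ →
        cQ = ∫ z, Qf z * (wNum F γ b₀ p₀ j Ts ρ ρ' Φ J t (X s) z / ∫ z', wNum F γ b₀ p₀ j Ts ρ ρ' Φ J t (X s) z' ∂τ) ∂τ → cR = ∫ z, Rf z * (wNum F γ b₀ p₀ j Ts ρ ρ' Φ J t (X s) z / ∫ z', wNum F γ b₀ p₀ j Ts ρ ρ' Φ J t (X s) z' ∂τ) ∂τ →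
          Integrable (fun z => (Pf z - cP) * (Qf z - cQ) * (Rf z - cR) * (wNum F γ b₀ p₀ j Ts ρ ρ' Φ J t (X s) z / ∫ z', wNum F γ b₀ p₀ j Ts ρ ρ' Φ J t (X s) z' ∂τ)) τ ∧
            |∫ z, (Pf z - cP) * (Qf z - cQ) * (Rf z - cR) * (wNum F γ b₀ p₀ j Ts ρ ρ' Φ J t (X s) z / ∫ z', wNum F γ b₀ p₀ j Ts ρ ρ' Φ J t (X s) z' ∂τ) ∂τ| ≤ ∑ a, ∑ b, ∑ c, |p a| * |q b| * |r c| * 𝒢₃ a b c)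
    -- (K1-path) ∕ (SC-PROF-X): profiles of the transported difference and of the score at the path law points; their masses
    (K Q₁ : ι → PBond (F.P j) 0 → ℝ) (ωX : ι → PBond (F.P j) 0 → ℝ) (Ncol Nrow : ℝ) (hK0 : ∀ a B, 0 ≤ K a B) (hQ0 : ∀ a B, 0 ≤ Q₁ a B) (hωX : ∀ a B, 0 ≤ ωX a B)
    (hNcol : 0 ≤ Ncol) (hNrow : 0 ≤ Nrow)
    (hKcol : ∀ B, ∑ a, K a B * ωX a B ≤ Ncol) (hKrow : ∀ c, ∑ B', K c B' * ωX c B' ≤ Ncol)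
    (hQrow : ∀ c, ∑ B', Q₁ c B' * ωX c B' ≤ Nrow) (hQcol : ∀ B, ∑ a, Q₁ a B * ωX a B ≤ Nrow)
    (htri : ∀ (B B' : PBond (F.P j) 0) (a c : ι), Real.exp (κ * (B.src.tdist B'.src : ℝ)) ≤ ωX a B * ωf a c * ωX c B')
    (htdsymm : ∀ B B' : PBond (F.P j) 0, (B.src.tdist B'.src : ℝ) = (B'.src.tdist B.src : ℝ))
    -- (K1-path) ∧ (S-PROF) ∧ (SC-PROF-X) at the path law points
    (hProfF : ∀ t : ℝ, 0 ≤ t → t ≤ 1 → ∀ (B B' : PBond (F.P j) 0) (m m' : Fin 3 → ℝ) (U₁ V₁ W₂ : GaugeField (F.P j) 0 ↥(Matrix.specialUnitaryGroup (Fin 2) ℂ)),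
      ‖m‖ ≤ rc * (θBal F.L γ b₀ p₀ j / 4) → ‖m'‖ ≤ rc * (θBal F.L γ b₀ p₀ j / 4) → PlaqSmall (θBal F.L γ b₀ p₀ j / 4) U₁ → PlaqSmall (θBal F.L γ b₀ p₀ j / 4) V₁ → PlaqSmall (θBal F.L γ b₀ p₀ j / 4) W₂ →
      (∀ e, e ≠ B → V₁ e = U₁ e) → V₁ B = U₁ B * expPt m → (∀ e, e ≠ B' → W₂ e = V₁ e) → W₂ B' = V₁ B' * expPt m' →
      ∀ (X : ℝ → GaugeField (F.P j) 0 ↥(Matrix.specialUnitaryGroup (Fin 2) ℂ)), (∀ s e, e ≠ B' → X s e = V₁ e) → (∀ s, X s B' = V₁ B' * expPt (s • m')) →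
      ∀ s ∈ Set.Icc (0:ℝ) 1,
        Prof (X s) (fun z => (Real.log (ρ Ts (Φ (V₁, z))) - Real.log (ρ' Ts (Φ (V₁, z)))) - (Real.log (ρ Ts (Φ (U₁, z))) - Real.log (ρ' Ts (Φ (U₁, z))))) (fun a => ‖m‖ / (θBal F.L γ b₀ p₀ j / 4) * K a B) ∧
          Prof (X s) (fun z => (Real.log (ρ Ts (Φ (V₁, z))) - Real.log (ρ' Ts (Φ (V₁, z)))) + (Real.log (ρ Ts (Φ (U₁, z))) - Real.log (ρ' Ts (Φ (U₁, z))))) KS ∧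
          Prof (X s) (fun z => deriv (fun s => wNum F γ b₀ p₀ j Ts ρ ρ' Φ J t (X s) z) s / wNum F γ b₀ p₀ j Ts ρ ρ' Φ J t (X s) z) (fun a => ‖m'‖ / (θBal F.L γ b₀ p₀ j / 4) * Q₁ a B'))
    -- the law facts at the path law points, a.e. in the path parameter
    (hlaw : ∀ t : ℝ, 0 ≤ t → t ≤ 1 → ∀ (B B' : PBond (F.P j) 0) (m m' : Fin 3 → ℝ) (U₁ V₁ W₂ : GaugeField (F.P j) 0 ↥(Matrix.specialUnitaryGroup (Fin 2) ℂ)),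
      ‖m‖ ≤ rc * (θBal F.L γ b₀ p₀ j / 4) → ‖m'‖ ≤ rc * (θBal F.L γ b₀ p₀ j / 4) → PlaqSmall (θBal F.L γ b₀ p₀ j / 4) U₁ → PlaqSmall (θBal F.L γ b₀ p₀ j / 4) V₁ → PlaqSmall (θBal F.L γ b₀ p₀ j / 4) W₂ →
      (∀ e, e ≠ B → V₁ e = U₁ e) → V₁ B = U₁ B * expPt m → (∀ e, e ≠ B' → W₂ e = V₁ e) → W₂ B' = V₁ B' * expPt m' →
      ∀ (X : ℝ → GaugeField (F.P j) 0 ↥(Matrix.specialUnitaryGroup (Fin 2) ℂ)), (∀ s e, e ≠ B' → X s e = V₁ e) → (∀ s, X s B' = V₁ B' * expPt (s • m')) →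
      ∀ᵐ s ∂(volume : Measure ℝ), s ∈ Set.Icc (0:ℝ) 1 →
        Integrable (fun z => (wNum F γ b₀ p₀ j Ts ρ ρ' Φ J t (X s) z / ∫ z', wNum F γ b₀ p₀ j Ts ρ ρ' Φ J t (X s) z' ∂τ)) τ ∧ ∫ z, (wNum F γ b₀ p₀ j Ts ρ ρ' Φ J t (X s) z / ∫ z', wNum F γ b₀ p₀ j Ts ρ ρ' Φ J t (X s) z' ∂τ) ∂τ = 1 ∧
        Integrable (fun z => ((Real.log (ρ Ts (Φ (V₁, z))) - Real.log (ρ' Ts (Φ (V₁, z)))) - (Real.log (ρ Ts (Φ (U₁, z))) - Real.log (ρ' Ts (Φ (U₁, z))))) * (wNum F γ b₀ p₀ j Ts ρ ρ' Φ J t (X s) z / ∫ z', wNum F γ b₀ p₀ j Ts ρ ρ' Φ J t (X s) z' ∂τ)) τ ∧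
        Integrable (fun z => ((Real.log (ρ Ts (Φ (V₁, z))) - Real.log (ρ' Ts (Φ (V₁, z)))) + (Real.log (ρ Ts (Φ (U₁, z))) - Real.log (ρ' Ts (Φ (U₁, z))))) * (wNum F γ b₀ p₀ j Ts ρ ρ' Φ J t (X s) z / ∫ z', wNum F γ b₀ p₀ j Ts ρ ρ' Φ J t (X s) z' ∂τ)) τ ∧
        Integrable (fun z => (deriv (fun s => wNum F γ b₀ p₀ j Ts ρ ρ' Φ J t (X s) z) s / wNum F γ b₀ p₀ j Ts ρ ρ' Φ J t (X s) z) * (wNum F γ b₀ p₀ j Ts ρ ρ' Φ J t (X s) z / ∫ z', wNum F γ b₀ p₀ j Ts ρ ρ' Φ J t (X s) z' ∂τ)) τ ∧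
        Integrable (fun z => ((Real.log (ρ Ts (Φ (V₁, z))) - Real.log (ρ' Ts (Φ (V₁, z)))) - (Real.log (ρ Ts (Φ (U₁, z))) - Real.log (ρ' Ts (Φ (U₁, z))))) * ((Real.log (ρ Ts (Φ (V₁, z))) - Real.log (ρ' Ts (Φ (V₁, z)))) + (Real.log (ρ Ts (Φ (U₁, z))) - Real.log (ρ' Ts (Φ (U₁, z))))) * (wNum F γ b₀ p₀ j Ts ρ ρ' Φ J t (X s) z / ∫ z', wNum F γ b₀ p₀ j Ts ρ ρ' Φ J t (X s) z' ∂τ)) τ ∧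
        Integrable (fun z => ((Real.log (ρ Ts (Φ (V₁, z))) - Real.log (ρ' Ts (Φ (V₁, z)))) - (Real.log (ρ Ts (Φ (U₁, z))) - Real.log (ρ' Ts (Φ (U₁, z))))) * (deriv (fun s => wNum F γ b₀ p₀ j Ts ρ ρ' Φ J t (X s) z) s / wNum F γ b₀ p₀ j Ts ρ ρ' Φ J t (X s) z) * (wNum F γ b₀ p₀ j Ts ρ ρ' Φ J t (X s) z / ∫ z', wNum F γ b₀ p₀ j Ts ρ ρ' Φ J t (X s) z' ∂τ)) τ ∧
        Integrable (fun z => ((Real.log (ρ Ts (Φ (V₁, z))) - Real.log (ρ' Ts (Φ (V₁, z)))) + (Real.log (ρ Ts (Φ (U₁, z))) - Real.log (ρ' Ts (Φ (U₁, z))))) * (deriv (fun s => wNum F γ b₀ p₀ j Ts ρ ρ' Φ J t (X s) z) s / wNum F γ b₀ p₀ j Ts ρ ρ' Φ J t (X s) z) * (wNum F γ b₀ p₀ j Ts ρ ρ' Φ J t (X s) z / ∫ z', wNum F γ b₀ p₀ j Ts ρ ρ' Φ J t (X s) z' ∂τ)) τ ∧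
        Integrable (fun z => ((Real.log (ρ Ts (Φ (V₁, z))) - Real.log (ρ' Ts (Φ (V₁, z)))) - (Real.log (ρ Ts (Φ (U₁, z))) - Real.log (ρ' Ts (Φ (U₁, z))))) * ((Real.log (ρ Ts (Φ (V₁, z))) - Real.log (ρ' Ts (Φ (V₁, z)))) + (Real.log (ρ Ts (Φ (U₁, z))) - Real.log (ρ' Ts (Φ (U₁, z))))) * (deriv (fun s => wNum F γ b₀ p₀ j Ts ρ ρ' Φ J t (X s) z) s / wNum F γ b₀ p₀ j Ts ρ ρ' Φ J t (X s) z) * (wNum F γ b₀ p₀ j Ts ρ ρ' Φ J t (X s) z / ∫ z', wNum F γ b₀ p₀ j Ts ρ ρ' Φ J t (X s) z' ∂τ)) τ)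
    (hM : Ncol * NG * Nrow ≤ M) :
    ∃ kV₃ : PBond (F.P j) 0 → PBond (F.P j) 0 → ℝ, (∀ B B', 0 ≤ kV₃ B B') ∧
      (∀ B, ∑ B', kV₃ B B' * Real.exp (κ * (B.src.tdist B'.src : ℝ)) ≤ M) ∧
      (∀ B', ∑ B, kV₃ B B' * Real.exp (κ * (B.src.tdist B'.src : ℝ)) ≤ M) ∧
      ∀ t : ℝ, 0 ≤ t → t ≤ 1 → ∀ (B B' : PBond (F.P j) 0) (m m' : Fin 3 → ℝ) (U₁ V₁ W₂ : GaugeField (F.P j) 0 ↥(Matrix.specialUnitaryGroup (Fin 2) ℂ)),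
        ‖m‖ ≤ rc * (θBal F.L γ b₀ p₀ j / 4) → ‖m'‖ ≤ rc * (θBal F.L γ b₀ p₀ j / 4) → PlaqSmall (θBal F.L γ b₀ p₀ j / 4) U₁ → PlaqSmall (θBal F.L γ b₀ p₀ j / 4) V₁ → PlaqSmall (θBal F.L γ b₀ p₀ j / 4) W₂ →
        (∀ e, e ≠ B → V₁ e = U₁ e) → V₁ B = U₁ B * expPt m → (∀ e, e ≠ B' → W₂ e = V₁ e) → W₂ B' = V₁ B' * expPt m' →
        ∀ (X : ℝ → GaugeField (F.P j) 0 ↥(Matrix.specialUnitaryGroup (Fin 2) ℂ)), (∀ s e, e ≠ B' → X s e = V₁ e) → (∀ s, X s B' = V₁ B' * expPt (s • m')) →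
        (∀ᵐ s ∂(volume : Measure ℝ), s ∈ Set.Icc (0:ℝ) 1 → |(((∫ z, (((Real.log (ρ Ts (Φ (V₁, z))) - Real.log (ρ' Ts (Φ (V₁, z)))) - (Real.log (ρ Ts (Φ (U₁, z))) - Real.log (ρ' Ts (Φ (U₁, z))))) * ((Real.log (ρ Ts (Φ (V₁, z))) - Real.log (ρ' Ts (Φ (V₁, z)))) + (Real.log (ρ Ts (Φ (U₁, z))) - Real.log (ρ' Ts (Φ (U₁, z)))))) * (deriv (fun s => wNum F γ b₀ p₀ j Ts ρ ρ' Φ J t (X s) z) s / wNum F γ b₀ p₀ j Ts ρ ρ' Φ J t (X s) z) * (wNum F γ b₀ p₀ j Ts ρ ρ' Φ J t (X s) z / ∫ z', wNum F γ b₀ p₀ j Ts ρ ρ' Φ J t (X s) z' ∂τ) ∂τ)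
                  - (∫ z, (((Real.log (ρ Ts (Φ (V₁, z))) - Real.log (ρ' Ts (Φ (V₁, z)))) - (Real.log (ρ Ts (Φ (U₁, z))) - Real.log (ρ' Ts (Φ (U₁, z))))) * ((Real.log (ρ Ts (Φ (V₁, z))) - Real.log (ρ' Ts (Φ (V₁, z)))) + (Real.log (ρ Ts (Φ (U₁, z))) - Real.log (ρ' Ts (Φ (U₁, z)))))) * (wNum F γ b₀ p₀ j Ts ρ ρ' Φ J t (X s) z / ∫ z', wNum F γ b₀ p₀ j Ts ρ ρ' Φ J t (X s) z' ∂τ) ∂τ) * (∫ z, (deriv (fun s => wNum F γ b₀ p₀ j Ts ρ ρ' Φ J t (X s) z) s / wNum F γ b₀ p₀ j Ts ρ ρ' Φ J t (X s) z) * (wNum F γ b₀ p₀ j Ts ρ ρ' Φ J t (X s) z / ∫ z', wNum F γ b₀ p₀ j Ts ρ ρ' Φ J t (X s) z' ∂τ) ∂τ))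
                - (((∫ z, ((Real.log (ρ Ts (Φ (V₁, z))) - Real.log (ρ' Ts (Φ (V₁, z)))) - (Real.log (ρ Ts (Φ (U₁, z))) - Real.log (ρ' Ts (Φ (U₁, z))))) * (deriv (fun s => wNum F γ b₀ p₀ j Ts ρ ρ' Φ J t (X s) z) s / wNum F γ b₀ p₀ j Ts ρ ρ' Φ J t (X s) z) * (wNum F γ b₀ p₀ j Ts ρ ρ' Φ J t (X s) z / ∫ z', wNum F γ b₀ p₀ j Ts ρ ρ' Φ J t (X s) z' ∂τ) ∂τ)
                      - (∫ z, ((Real.log (ρ Ts (Φ (V₁, z))) - Real.log (ρ' Ts (Φ (V₁, z)))) - (Real.log (ρ Ts (Φ (U₁, z))) - Real.log (ρ' Ts (Φ (U₁, z))))) * (wNum F γ b₀ p₀ j Ts ρ ρ' Φ J t (X s) z / ∫ z', wNum F γ b₀ p₀ j Ts ρ ρ' Φ J t (X s) z' ∂τ) ∂τ) * (∫ z, (deriv (fun s => wNum F γ b₀ p₀ j Ts ρ ρ' Φ J t (X s) z) s / wNum F γ b₀ p₀ j Ts ρ ρ' Φ J t (X s) z) * (wNum F γ b₀ p₀ j Ts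 ρ ρ' Φ J t (X s) z / ∫ z', wNum F γ b₀ p₀ j Ts ρ ρ' Φ J t (X s) z' ∂τ) ∂τ))
                    * (∫ z, ((Real.log (ρ Ts (Φ (V₁, z))) - Real.log (ρ' Ts (Φ (V₁, z)))) + (Real.log (ρ Ts (Φ (U₁, z))) - Real.log (ρ' Ts (Φ (U₁, z))))) * (wNum F γ b₀ p₀ j Ts ρ ρ' Φ J t (X s) z / ∫ z', wNum F γ b₀ p₀ j Ts ρ ρ' Φ J t (X s) z' ∂τ) ∂τ)
                  + (∫ z, ((Real.log (ρ Ts (Φ (V₁, z))) - Real.log (ρ' Ts (Φ (V₁, z)))) - (Real.log (ρ Ts (Φ (U₁, z))) - Real.log (ρ' Ts (Φ (U₁, z))))) * (wNum F γ b₀ p₀ j Ts ρ ρ' Φ J t (X s) z / ∫ z', wNum F γ b₀ p₀ j Ts ρ ρ' Φ J t (X s) z' ∂τ) ∂τ)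
                    * ((∫ z, ((Real.log (ρ Ts (Φ (V₁, z))) - Real.log (ρ' Ts (Φ (V₁, z)))) + (Real.log (ρ Ts (Φ (U₁, z))) - Real.log (ρ' Ts (Φ (U₁, z))))) * (deriv (fun s => wNum F γ b₀ p₀ j Ts ρ ρ' Φ J t (X s) z) s / wNum F γ b₀ p₀ j Ts ρ ρ' Φ J t (X s) z) * (wNum F γ b₀ p₀ j Ts ρ ρ' Φ J t (X s) z / ∫ z', wNum F γ b₀ p₀ j Ts ρ ρ' Φ J t (X s) z' ∂τ) ∂τ)
                      - (∫ z, ((Real.log (ρ Ts (Φ (V₁, z))) - Real.log (ρ' Ts (Φ (V₁, z)))) + (Real.log (ρ Ts (Φ (U₁, z))) - Real.log (ρ' Ts (Φ (U₁, z))))) * (wNum F γ b₀ p₀ j Ts ρ ρ' Φ J t (X s) z / ∫ z', wNum F γ b₀ p₀ j Ts ρ ρ' Φ J t (X s) z' ∂τ) ∂τ) * (∫ z, (deriv (fun s => wNum F γ b₀ p₀ j Ts ρ ρ' Φ J t (X s) z) s / wNum F γ b₀ p₀ j Ts ρ ρ' Φ J t (X s) z) * (wNum F γ b₀ p₀ j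 Ts ρ ρ' Φ J t (X s) z / ∫ z', wNum F γ b₀ p₀ j Ts ρ ρ' Φ J t (X s) z' ∂τ) ∂τ))))| ≤ kV₃ B B' * (‖m‖ / (θBal F.L γ b₀ p₀ j / 4)) * (‖m'‖ / (θBal F.L γ b₀ p₀ j / 4))) := by
  exact kerV3Clause_of_cum3Kernel_profiles τ
    (fun V z => Real.log (ρ Ts (Φ (V, z))) - Real.log (ρ' Ts (Φ (V, z))))
    (fun t Xw z => wNum F γ b₀ p₀ j Ts ρ ρ' Φ J t Xw z / ∫ z', wNum F γ b₀ p₀ j Ts ρ ρ' Φ J t Xw z' ∂τ)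
    (fun t X s z => deriv (fun s => wNum F γ b₀ p₀ j Ts ρ ρ' Φ J t (X s) z) s / wNum F γ b₀ p₀ j Ts ρ ρ' Φ J t (X s) z)
    (θBal F.L γ b₀ p₀ j / 4) rc κ M (by positivity) Prof 𝒢₃ KS ωf NG hG0 hKS0 hωf hNG hGrow hGcol hωfsymm hCum K Q₁ ωX Ncol Nrow hK0 hQ0 hωX hNcol hNrow
    hKcol hKrow hQrow hQcol htri htdsymm hProfF hlaw hM

end Organ

end Summit.QuantumFields.YangMills.Theorems.OrganTangentILawKerV3OfScoreProfile

end
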